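import Literature.InformationTheory.QuantumCodes.RotatedSurfaceCodeDistance
import Literature.InformationTheory.QuantumCodes.OptimalRadius
import Literature.InformationTheory.QuantumCodes.CSSEquivalence
import HarnessLib

/-!
# Shor's code family `⟦m², 1, m⟧`: the `m`-block concatenation of the `m`-qubit repetition codes, for every `m ≥ 1`

Topic `InformationTheory/QuantumCodes`; namespace `Literature.InformationTheory.QuantumCodes.ShorCode`. LADDER-QEC (cell
`qec`), PARTITION row 08, item 08.SHOR (family theorem + Q4 radius; textbook family — replication / family-theorem class,
no priority claim).

THE CODE (Shor 1995 for `m = 3`; Nielsen–Chuang §10.2). Qubits `Fin m × Fin m`, `(i, j)` = qubit `j` of block `i`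
(block-major). `Z`-checks `Z_{(i,j)} Z_{(i,j+1)}` (`i < m`, `j < m − 1`: the repetition-code checks inside each block —
«comparing the first and second qubits, and then the second and third»); `X`-checks `X^{⊗ block i} X^{⊗ block i+1}`
(`i < m − 1`; for `m = 3` the observables `X₁X₂X₃X₄X₅X₆` and `X₄X₅X₆X₇X₈X₉` of Nielsen–Chuang Exercise 10.5). As a
check-matrix CSS code: `ShorCode.code m = CSSCode.ofMatrices (HX m) (HZ m) _`.

PRINTED CLAIM (Nguyen et al. 2021 §II, stated without proof): «An `[[m², 1, m]]` Shor code uses `m × m` physical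
qubits to encode a single logical qubit with distance `m` … It is constructed from the concatenation of an `m`-bit
repetition code that corrects `X` errors with an `m`-bit repetition code that corrects `Z` errors.» PROVED here for
every `m ≥ 1`: ★ `code_isCode : 0 < m → (code m).IsCode (m * m) 1 m`, with `code_k`, `code_dZ`, `code_dX`
separately; instances `shor9_isCode` (`⟦9,1,3⟧`, Shor's code), `shor16_isCode` (`⟦16,1,4⟧`), `shor25_isCode`
(`⟦25,1,5⟧`); Q4 (decoder column): `code_minWeight_correctsUpTo` (sector-wise minimum-weight decoding corrects every
pattern of weight `≤ ⌊(m−1)/2⌋`) and `code_radius_optimal` (no pair of sector decoders does better); and on the flat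
qubit type `Fin (m·m)` (block-major, `(i, j) ↦ m·i + j`, Mathlib's `finProdFinEquiv`): `codeFlat m`, `codeFlat_isCode`,
and the Pauli-level packaged radius `codeFlat_hasOptimalRadius : (codeFlat m).HasOptimalRadius ((m − 1) / 2)` (some
Pauli decoder attains symplectic-weight radius `⌊(m−1)/2⌋` and NO Pauli decoder, sector-wise or not, corrects more).

PROOF. `k = 1`: the `m − 1` `X`-rows and the `m(m−1)` `Z`-rows are triangular families
(`linearIndependent_of_pivot`), so `k = m² − (m−1) − m(m−1) = 1`. `d_Z = m` by the tree's homology-free engine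
`CSSCode.dZ_eq_of_disjoint_lines` (CSSDisjointLogicals.lean): the `m` BLOCKS are pairwise disjoint representatives of
the logical `X̄` (consecutive blocks differ by an `X`-check; `H_Z · block = 0`) and the TRANSVERSAL `{(i,0)}_i` (one
qubit per block) is a `Z`-logical of weight `m` meeting block `0` once; `d_X = m` by the same engine on the
`X ↔ Z`-exchanged code: the `m` transversals `{(i,j)}_i` are disjoint representatives of `Z̄` (consecutive ones differ by
the `Z`-checks `(i,j)`, `i < m`) and block `0` is an `X`-logical of weight `m`. The row/column indicator vectors and
their bookkeeping lemmas are REUSED from `RotatedSurfaceCode.lean` (`RotatedSurface.row/col`, same qubit grid).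

0 named facts, no `decide` on data, no instances/notation; axioms standard.

## References
* [Shor1995] P. W. Shor, «Scheme for reducing decoherence in quantum computer memory», Phys. Rev. A 52 (1995)
  R2493 (the nine-qubit code).
* [NielsenChuang2010] §10.2 «The Shor code» (held: chunk p0509 L9–22, p0510 L3–7; Exercise 10.5: the `X`-type
  syndrome observables `X₁X₂X₃X₄X₅X₆`, `X₄X₅X₆X₇X₈X₉`).
* [NguyenEtAl2021] N. H. Nguyen et al., «Demonstration of Shor encoding on a trapped-ion quantum computer», Phys. Rev.
  Applied 16 (2021) 024057 = arXiv:2104.01205, §I (chunk p0001 L17: «larger `[[m², 1, m]]` Shor codes can be generated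
  using m-modular redundancy») and §II (chunk p0002 L11: the sentence quoted above).
* [LinPryadko2024] H.-K. Lin, L. P. Pryadko, arXiv:2306.16400 §4.2 Thm 6 (permutation equivalence preserves parameters —
  the tree's FACT P `CSSCode.reindex_isCode_iff`, CSSEquivalence.lean).
* [Gottesman1997] D. Gottesman, PhD thesis, §2.3 (chunk p0014 L3: a distance-`2t+1` code corrects `t` errors).
-/

namespace Literature.InformationTheory.QuantumCodes

open Matrix Finset

namespace ShorCode

open RotatedSurface (row col row_disjoint col_disjoint row_dotProduct_col col_dotProduct_row hammingNorm_row_le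
  hammingNorm_col_le sum_mul_pair_indicator)

variable {m : ℕ}

/-! ## Check matrices -/

/-- `X`-check `i` (`i < m − 1`) of Shor's `m × m` code: `X` on every qubit of blocks `i` and `i + 1`.
(definition) [cite: NielsenChuang2010, §10.2 Exercise 10.5 (chunk p0510 L7: X₁X₂X₃X₄X₅X₆ and X₄X₅X₆X₇X₈X₉)] [cite: NguyenEtAl2021, §II (chunk p0002 L11)] -/
def HX (m : ℕ) : Matrix (Fin (m - 1)) (Fin m × Fin m) (ZMod 2) :=
  fun i q => if q.1.val = i.val ∨ q.1.val = i.val + 1 then 1 else 0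

/-- `Z`-check `(i, j)` (`j < m − 1`) of Shor's `m × m` code: `Z_{(i,j)} Z_{(i,j+1)}` inside block `i`.
(definition) [cite: NielsenChuang2010, §10.2 (chunk p0510 L3: «comparing the first and second qubits, and then the second and third») ] [cite: NguyenEtAl2021, §II (chunk p0002 L11)] -/
def HZ (m : ℕ) : Matrix (Fin m × Fin (m - 1)) (Fin m × Fin m) (ZMod 2) :=
  fun z q => if q.1 = z.1 then (if q.2.val = z.2.val ∨ q.2.val = z.2.val + 1 then 1 else 0) else 0

/-- Entries of `H_X`. [cite: NielsenChuang2010, §10.2 Exercise 10.5 (chunk p0510 L7)] -/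
theorem HX_apply (i : Fin (m - 1)) (q : Fin m × Fin m) :
    HX m i q = if q.1.val = i.val ∨ q.1.val = i.val + 1 then 1 else 0 := rfl

/-- Entries of `H_Z`. [cite: NielsenChuang2010, §10.2 (chunk p0510 L3)] -/
theorem HZ_apply (z : Fin m × Fin (m - 1)) (q : Fin m × Fin m) :
    HZ m z q = if q.1 = z.1 then (if q.2.val = z.2.val ∨ q.2.val = z.2.val + 1 then 1 else 0) else 0 := rfl

/-- **Commutation** `H_X H_Zᵀ = 0`: an `X`-check meets a `Z`-check of a block it covers in both of its qubits.
[cite: NielsenChuang2010, §10.2 (chunk p0510 L3–7)] -/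
theorem HX_mul_HZ_transpose (m : ℕ) : HX m * (HZ m)ᵀ = 0 := by
  ext x z
  simp only [Matrix.mul_apply, Matrix.transpose_apply, HX_apply, HZ_apply, Matrix.zero_apply]
  rw [Fintype.sum_prod_type]
  have hz : z.2.val + 1 < m := by have := z.2.isLt; omega
  have hin : ∀ a : Fin m, ∑ b : Fin m, (if a.val = x.val ∨ a.val = x.val + 1 then (1 : ZMod 2) else 0) *
        (if a = z.1 then (if b.val = z.2.val ∨ b.val = z.2.val + 1 then 1 else 0) else 0)
      = (if a.val = x.val ∨ a.val = x.val + 1 then (1 : ZMod 2) else 0) * (if a = z.1 then 1 else 0) *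
        ∑ b : Fin m, (1 : ZMod 2) * (if b.val = z.2.val ∨ b.val = z.2.val + 1 then 1 else 0) := by
    intro a
    rw [Finset.mul_sum]
    refine Finset.sum_congr rfl fun b _ => ?_
    split_ifs <;> simp
  simp_rw [hin, sum_mul_pair_indicator _ z.2.val hz]
  have h2 : (1 : ZMod 2) + 1 = 0 := by decide
  simp [h2]

/-- **Shor's `m × m` code** as a check-matrix CSS code on the qubit grid `Fin m × Fin m` (block-major). (definition)
[cite: Shor1995, (the nine-qubit code, m = 3)] [cite: NguyenEtAl2021, §II (chunk p0002 L11: «An [[m², 1, m]] Shor code uses m × m physical qubits»)] -/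
def code (m : ℕ) : CSSCode (Fin (m - 1)) (Fin m × Fin (m - 1)) (Fin m × Fin m) :=
  CSSCode.ofMatrices (HX m) (HZ m) (HX_mul_HZ_transpose m)

/-- `(code m).HX = HX m`. [cite: NielsenChuang2010, §10.2 Exercise 10.5 (chunk p0510 L7)] -/
@[simp] theorem code_HX (m : ℕ) : (code m).HX = HX m := rfl

/-- `(code m).HZ = HZ m`. [cite: NielsenChuang2010, §10.2 (chunk p0510 L3)] -/
@[simp] theorem code_HZ (m : ℕ) : (code m).HZ = HZ m := rfl

/-! ## `k = 1`: the checks are independent -/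

/-- The `X`-checks are linearly independent (triangular: check `i` is the last one touching block `i + 1`… read
downwards, check `i` is the first touching block `i`). [cite: NielsenChuang2010, §10.5.6 (independent stabilizer generators of the Shor code, Fig. 10.11)] -/
theorem linearIndependent_HX : LinearIndependent (ZMod 2) (fun i : Fin (m - 1) => HX m i) := by
  refine linearIndependent_of_pivot _ (fun i => m - i.val)
    (fun i => ((⟨i.val, by have := i.isLt; omega⟩ : Fin m), (⟨0, by have := i.isLt; omega⟩ : Fin m))) ?_ ?_
  · intro i
    rw [HX_apply]
    simp
  · intro i j hji hkey
    have hne : i.val ≠ j.val := fun h => hji (Fin.ext h).symm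
    have hkey' : m - j.val ≤ m - i.val := hkey
    have hne' : i.val ≠ j.val + 1 := by
      intro h; have := j.isLt; have := i.isLt; omega
    rw [HX_apply]
    simp [hne, hne']

/-- The `Z`-checks are linearly independent (inside each block, check `(i, j)` is the last one touching qubit
`(i, j+1)`). [cite: NielsenChuang2010, §10.5.6 (independent stabilizer generators of the Shor code, Fig. 10.11)] -/
theorem linearIndependent_HZ : LinearIndependent (ZMod 2) (fun z : Fin m × Fin (m - 1) => HZ m z) := by
  refine linearIndependent_of_pivot _ (fun z => z.2.val)
    (fun z => (z.1, (⟨z.2.val + 1, by have := z.2.isLt; omega⟩ : Fin m))) ?_ ?_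
  · intro z
    rw [HZ_apply]
    simp
  · intro z w hwz hkey
    have hkey' : w.2.val ≤ z.2.val := hkey
    rw [HZ_apply]
    by_cases h1 : z.1 = w.1
    · have hne : w.2.val ≠ z.2.val := by
        intro h; apply hwz; exact Prod.ext h1.symm (Fin.ext h)
      have ha : z.2.val + 1 ≠ w.2.val := by omega
      have hb : z.2.val ≠ w.2.val := fun h => hne h.symm
      simp [h1, ha, hb]
    · simp [h1]

/-- `rank H_X = m − 1`. [cite: NielsenChuang2010, §10.5.6 (Fig. 10.11: two X-type generators for m = 3)] -/
theorem rank_HX (m : ℕ) : (HX m).rank = m - 1 := by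
  classical
  rw [rank_eq_card_of_rows (HX m) (fun _ => True) ?_ (fun r h => (h trivial).elim)]
  · simp
  · exact linearIndependent_HX.comp (fun r : {r : Fin (m - 1) // True} => r.1) fun a b h => Subtype.ext h

/-- `rank H_Z = m(m − 1)`. [cite: NielsenChuang2010, §10.5.6 (Fig. 10.11: six Z-type generators for m = 3)] -/
theorem rank_HZ (m : ℕ) : (HZ m).rank = m * (m - 1) := by
  classical
  rw [rank_eq_card_of_rows (HZ m) (fun _ => True) ?_ (fun r h => (h trivial).elim)]
  · simp
  · exact linearIndependent_HZ.comp (fun r : {r : Fin m × Fin (m - 1) // True} => r.1) fun a b h => Subtype.ext h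

/-- **`k = 1`** for Shor's `m × m` code, every `m ≥ 1`: `m² − (m − 1) − m(m − 1) = 1`.
[cite: NguyenEtAl2021, §II (chunk p0002 L11: «to encode a single logical qubit»)] [cite: NielsenChuang2010, §10.2 (chunk p0509 L11)] -/
theorem code_k (hm : 0 < m) : (code m).k = 1 := by
  rw [CSSCode.k_eq, code_HX, code_HZ, rank_HX, rank_HZ, RotatedSurface.card_qubits]
  obtain ⟨n, rfl⟩ : ∃ n, m = n + 1 := ⟨m - 1, by omega⟩
  simp only [Nat.add_sub_cancel]
  have : (n + 1) * (n + 1) = n + (n + 1) * n + 1 := by ring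
  omega

/-! ## The logical lines: blocks and transversals -/

/-- `H_Z · (block i) = 0`: a `Z`-check meets a block in `0` or `2` qubits. [cite: NielsenChuang2010, §10.2 (chunk p0510 L5: a phase flip acts on a whole block)] -/
theorem HZ_mulVec_row (i : Fin m) : HZ m *ᵥ row i = 0 := by
  funext z
  simp only [mulVec, dotProduct, HZ_apply, RotatedSurface.row, Pi.zero_apply]
  rw [Fintype.sum_prod_type]
  have hz : z.2.val + 1 < m := by have := z.2.isLt; omega
  have hin : ∀ a : Fin m, ∑ b : Fin m,
      (if a = z.1 then (if b.val = z.2.val ∨ b.val = z.2.val + 1 then (1 : ZMod 2) else 0) else 0) *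
        (if a = i then 1 else 0)
      = (if a = z.1 then (1 : ZMod 2) else 0) * (if a = i then 1 else 0) *
        ∑ b : Fin m, (1 : ZMod 2) * (if b.val = z.2.val ∨ b.val = z.2.val + 1 then 1 else 0) := by
    intro a
    rw [Finset.mul_sum]
    refine Finset.sum_congr rfl fun b _ => ?_
    split_ifs <;> simp
  simp_rw [hin, sum_mul_pair_indicator _ z.2.val hz]
  have h2 : (1 : ZMod 2) + 1 = 0 := by decide
  simp [h2]

/-- `H_X · (transversal j) = 0`: an `X`-check meets the transversal `{(i, j)}_i` in exactly the `2` qubits `(i, j)`,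
`(i+1, j)`. [cite: NielsenChuang2010, §10.2 (chunk p0510 L3–7)] -/
theorem HX_mulVec_col (j : Fin m) : HX m *ᵥ col j = 0 := by
  funext x
  simp only [mulVec, dotProduct, HX_apply, RotatedSurface.col, Pi.zero_apply]
  rw [Fintype.sum_prod_type]
  have hx : x.val + 1 < m := by have := x.isLt; omega
  have hin : ∀ a : Fin m, ∑ b : Fin m,
      (if a.val = x.val ∨ a.val = x.val + 1 then (1 : ZMod 2) else 0) * (if b = j then 1 else 0)
      = (1 : ZMod 2) * (if a.val = x.val ∨ a.val = x.val + 1 then 1 else 0) := by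
    intro a
    simp [Finset.sum_ite_eq']
  simp_rw [hin]
  rw [sum_mul_pair_indicator (fun _ : Fin m => (1 : ZMod 2)) x.val hx]
  decide

/-- **Strip lemma, blocks**: `block i + block (i+1) = H_X` row `i`, hence `∈ rs H_X` — consecutive blocks are
stabilizer-equivalent representatives of `X̄`. [cite: NielsenChuang2010, §10.2 Exercise 10.5 (chunk p0510 L7)] -/
theorem row_add_row_mem_rowSpX (i i' : Fin m) (hi : i'.val = i.val + 1) : row i + row i' ∈ (code m).rowSpX := by
  classical
  have him : i.val < m - 1 := by have := i'.isLt; omega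
  refine mem_rowSpace_of_vecMul_eq (Pi.single (⟨i.val, him⟩ : Fin (m - 1)) 1) ?_
  rw [Matrix.single_one_vecMul, Matrix.row_apply']
  funext q
  rw [code_HX, HX_apply]
  simp only [Pi.add_apply, RotatedSurface.row]
  have e1 : (q.1 = i) = (q.1.val = i.val) := propext Fin.ext_iff
  have e2 : (q.1 = i') = (q.1.val = i.val + 1) := by rw [← hi]; exact propext Fin.ext_iff
  simp only [e1, e2]
  by_cases h1 : q.1.val = i.val
  · have h2 : q.1.val ≠ i.val + 1 := by omega
    simp [h1]
  · by_cases h2 : q.1.val = i.val + 1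
    · simp [h2]
    · simp [h1, h2]

/-- **Strip lemma, transversals**: `transversal j + transversal (j+1) = Σ_i H_Z (i, j)`, hence `∈ rs H_Z` — consecutive
transversals are stabilizer-equivalent representatives of `Z̄`. [cite: NielsenChuang2010, §10.2 (chunk p0510 L3)] -/
theorem col_add_col_mem_rowSpZ (j j' : Fin m) (hj : j'.val = j.val + 1) : col j + col j' ∈ (code m).rowSpZ := by
  have hjm : j.val < m - 1 := by have := j'.isLt; omega
  set b : Fin (m - 1) := ⟨j.val, hjm⟩ with hb
  refine mem_rowSpace_of_vecMul_eq (fun z : Fin m × Fin (m - 1) => if z.2 = b then 1 else 0) ?_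
  funext q
  simp only [vecMul, dotProduct, code_HZ, HZ_apply, Pi.add_apply, RotatedSurface.col]
  rw [Fintype.sum_prod_type]
  -- the inner sum over `b'` picks `b' = b`; the outer sum over blocks `a` picks `a = q.1`
  have hin : ∀ a : Fin m, ∑ b' : Fin (m - 1), (if b' = b then (1 : ZMod 2) else 0) *
        (if q.1 = a then (if q.2.val = b'.val ∨ q.2.val = b'.val + 1 then 1 else 0) else 0)
      = if q.1 = a then (if q.2.val = j.val ∨ q.2.val = j.val + 1 then 1 else 0) else 0 := by
    intro a
    simp only [ite_mul, one_mul, zero_mul, Finset.sum_ite_eq', Finset.mem_univ, if_true, hb]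
  simp_rw [hin]
  rw [Finset.sum_ite_eq Finset.univ q.1]
  simp only [Finset.mem_univ, if_true]
  have e1 : (q.2 = j) = (q.2.val = j.val) := propext Fin.ext_iff
  have e2 : (q.2 = j') = (q.2.val = j.val + 1) := by rw [← hj]; exact propext Fin.ext_iff
  simp only [e1, e2]
  by_cases h1 : q.2.val = j.val
  · have h2 : q.2.val ≠ j.val + 1 := by omega
    simp [h1]
  · by_cases h2 : q.2.val = j.val + 1
    · simp [h2]
    · simp [h1, h2]

/-! ## Distances and parameters -/

/-- **`d_Z = m`**: the `m` blocks are disjoint representatives of `X̄` differing by `X`-checks, and the transversal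
`{(i, 0)}_i` is a `Z`-logical of weight `m` meeting block `0` once («any two orthogonal logical states differ by at
least m … phase-flips»). [cite: NguyenEtAl2021, §II (chunk p0002 L11)] -/
theorem code_dZ (hm : 0 < m) : (code m).dZ = m := by
  refine (code m).dZ_eq_of_disjoint_lines hm row row_disjoint row_add_row_mem_rowSpX ?_ (col ⟨0, hm⟩) ?_ ?_
    (hammingNorm_col_le _) (code_k hm)
  · rw [code_HZ]; exact HZ_mulVec_row _
  · rw [code_HX]; exact HX_mulVec_col _
  · exact col_dotProduct_row _ _

/-- **`d_X = m`**: the `m` transversals are disjoint representatives of `Z̄` differing by `Z`-checks, and block `0`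
is an `X`-logical of weight `m` («… differ by at least m bit-flips»; the engine applied to the `X ↔ Z` exchanged code).
[cite: NguyenEtAl2021, §II (chunk p0002 L11)] -/
theorem code_dX (hm : 0 < m) : (code m).dX = m := by
  rw [← CSSCode.dZ_swap]
  refine (code m).swap.dZ_eq_of_disjoint_lines hm col col_disjoint ?_ ?_ (row ⟨0, hm⟩) ?_ ?_
    (hammingNorm_row_le _) (by rw [CSSCode.k_swap]; exact code_k hm)
  · intro j j' h
    exact col_add_col_mem_rowSpZ j j' h
  · show (code m).HX *ᵥ col ⟨0, hm⟩ = 0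
    rw [code_HX]; exact HX_mulVec_col _
  · show (code m).HZ *ᵥ row ⟨0, hm⟩ = 0
    rw [code_HZ]; exact HZ_mulVec_row _
  · exact row_dotProduct_col _ _

/-- **Shor's `m × m` code is `⟦m², 1, m⟧`, for every `m ≥ 1`** (PRINTED CLAIM of Nguyen et al. §II, proved).
[cite: NguyenEtAl2021, §II (chunk p0002 L11: «An [[m², 1, m]] Shor code uses m × m physical qubits to encode a single logical qubit with distance m»)] [cite: Shor1995, (m = 3)] -/
theorem code_isCode (hm : 0 < m) : (code m).IsCode (m * m) 1 m := by
  have hk := code_k hm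
  have h := (code m).isCode_of_dX_dZ (by rw [hk]; exact one_pos) (code_dX hm) (code_dZ hm)
  rwa [RotatedSurface.card_qubits, hk, min_self] at h

/-- `m = 3`: **Shor's nine-qubit code is `⟦9, 1, 3⟧`.** [cite: Shor1995, (the nine-qubit code)] [cite: NielsenChuang2010, §10.2 (chunk p0509 L11: «protect against the effects of an arbitrary error on a single qubit»)] -/
theorem shor9_isCode : (code 3).IsCode 9 1 3 := code_isCode (m := 3) (by norm_num)

/-- `m = 4`: `⟦16, 1, 4⟧`. [cite: NguyenEtAl2021, §II (chunk p0002 L11) and §IV (chunk p0006 L7: even m)] -/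
theorem shor16_isCode : (code 4).IsCode 16 1 4 := code_isCode (m := 4) (by norm_num)

/-- `m = 5`: `⟦25, 1, 5⟧`. [cite: NguyenEtAl2021, §IV (chunk p0006 L3: «the [[25, 1, 5]] code»)] -/
theorem shor25_isCode : (code 5).IsCode 25 1 5 := code_isCode (m := 5) (by norm_num)

/-! ## Q4: correction radius -/

/-- **Correction radius of Shor's `m × m` code, attained**: minimum-weight decoding of each sector corrects every
pattern of weight `≤ ⌊(m−1)/2⌋` (for `m = 3`: every single-qubit error). [cite: NielsenChuang2010, §10.2 (chunk p0510 L3–7: correcting a bit flip / phase flip on any qubit)] [cite: NguyenEtAl2021, §II (chunk p0002 L11)] -/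
theorem code_minWeight_correctsUpTo (hm : 0 < m) :
    (Decoder.minWeight (code m).zSyndrome hammingNorm).CorrectsUpTo (code m).zSyndrome
        ((code m).rowSpZ : Set (Fin m × Fin m → ZMod 2)) hammingNorm ((m - 1) / 2) ∧
      (Decoder.minWeight (code m).xSyndrome hammingNorm).CorrectsUpTo (code m).xSyndrome
        ((code m).rowSpX : Set (Fin m × Fin m → ZMod 2)) hammingNorm ((m - 1) / 2) :=
  ⟨(code_isCode hm).minWeight_correctsUpToZ, (code_isCode hm).minWeight_correctsUpToX⟩

/-- **… and optimal**: no pair of sector decoders of Shor's `m × m` code corrects all weight-`t` patterns in both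
sectors unless `t ≤ ⌊(m−1)/2⌋`. [cite: NguyenEtAl2021, §II (chunk p0002 L11: «For the [[9,1,3]] Shor code only a single physical error can be diagnosed unambiguously»)] -/
theorem code_radius_optimal (hm : 0 < m) {DX : Decoder (Fin m × Fin (m - 1) → ZMod 2) (Fin m × Fin m → ZMod 2)}
    {DZ : Decoder (Fin (m - 1) → ZMod 2) (Fin m × Fin m → ZMod 2)} {t : ℕ}
    (hDX : DX.CorrectsUpTo (code m).xSyndrome ((code m).rowSpX : Set (Fin m × Fin m → ZMod 2)) hammingNorm t)
    (hDZ : DZ.CorrectsUpTo (code m).zSyndrome ((code m).rowSpZ : Set (Fin m × Fin m → ZMod 2)) hammingNorm t) :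
    t ≤ (m - 1) / 2 :=
  (code_isCode hm).le_half_of_correctsUpTo_sectors hDX hDZ

/-! ## The flat form on `Fin (m·m)` and the Pauli-level radius -/

/-- Shor's `m × m` code on the flat qubit type `Fin (m·m)`, block-major (`(i, j) ↦ m·i + j`, Mathlib's
`finProdFinEquiv`); check index types unchanged. (definition) [cite: NguyenEtAl2021, §II (chunk p0002 L11)] [cite: NielsenChuang2010, §10.2 (chunk p0509 L11: qubits 1…9 in three blocks)] -/
def codeFlat (m : ℕ) : CSSCode (Fin (m - 1)) (Fin m × Fin (m - 1)) (Fin (m * m)) :=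
  (code m).reindex (Equiv.refl _) (Equiv.refl _) finProdFinEquiv

/-- The flat form is `⟦m², 1, m⟧` (re-indexing preserves parameters, FACT P). [cite: NguyenEtAl2021, §II (chunk p0002 L11)] [cite: LinPryadko2024, §4.2 Thm 6 (arXiv:2306.16400 p0009 L66-74: permutation-equivalent codes have the same parameters)] -/
theorem codeFlat_isCode (hm : 0 < m) : (codeFlat m).IsCode (m * m) 1 m :=
  ((code m).reindex_isCode_iff _ _ _ (m * m) 1 m).2 (code_isCode hm)

/-- `m = 3`, flat: Shor's nine-qubit code on `Fin 9` is `⟦9, 1, 3⟧`. [cite: Shor1995, (the nine-qubit code)] -/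
theorem shor9Flat_isCode : (codeFlat 3).IsCode 9 1 3 := codeFlat_isCode (m := 3) (by norm_num)

/-- **Q4, Pauli level: the optimal correction radius of Shor's `m × m` code is `⌊(m−1)/2⌋`, attained** — some Pauli
decoder (sector-wise minimum-weight decoding) corrects every Pauli error of symplectic weight `≤ ⌊(m−1)/2⌋`, and NO Pauli
decoder whatsoever corrects every Pauli error of weight `≤ ⌊(m−1)/2⌋ + 1` (the tree's `CSSCode.HasOptimalRadius`).
[cite: NguyenEtAl2021, §II (chunk p0002 L11: distance m; «only a single physical error can be diagnosed unambiguously» for m = 3)] [cite: Gottesman1997, §2.3 (chunk p0014 L3: distance 2t+1 corrects t errors)] -/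
theorem codeFlat_hasOptimalRadius (hm : 0 < m) : (codeFlat m).HasOptimalRadius ((m - 1) / 2) :=
  (codeFlat_isCode hm).hasOptimalRadius_of_eq rfl

/-- `m = 3`: Shor's nine-qubit code corrects every single-qubit Pauli error and no Pauli decoder corrects all
two-qubit errors (optimal radius `1`). [cite: NielsenChuang2010, §10.2 (chunk p0509 L11: «protect against the effects of an arbitrary error on a single qubit»)] -/
theorem shor9Flat_hasOptimalRadius : (codeFlat 3).HasOptimalRadius 1 := codeFlat_hasOptimalRadius (m := 3) (by norm_num)

end ShorCode

end Literature.InformationTheory.QuantumCodes
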